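import Summits.Parity.GeneralizedHardyLittlewood.Theorems.LeeYangFibresRelativeDimOneTypeRigidity
import Summits.Parity.GeneralizedHardyLittlewood.Theorems.LeeYangFibresRelativeDimOneTypeSingularWeights
import Summits.Parity.GeneralizedHardyLittlewood.Theorems.LeeYangFibresRelativeDimOneTypeEndgame
import Summits.Parity.GeneralizedHardyLittlewood.Theorems.LeeYangFibresRelativeDimOneSplitEulerExpansion
import Summits.Parity.GeneralizedHardyLittlewood.Theorems.PairsToGHL.Negative.ShiftPairDictionary
import Literature.Barriers.Parity.SiegelZeroPrimePairs
import Literature.Barriers.Parity.SiegelZeroPrimePairsProofs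
import Literature.Barriers.Parity.SiegelZeroDichotomy
import Literature.NumberTheory.Sieve.MontgomeryVaughan1975Tools
import HarnessLib

/-!
# Route `LeeYangFibres`, crux `RelativeDimOne` (stmt-Parity-14113), line `floating-level-core`:
# the registered stub `stub_siegelRepulsion` — the bare parity atom repels Siegel zeros

`IncidenceBandlimitedCoreDecay θ` (vocabulary `LeeYangFibresRelativeDimOneTypeDefs`) ALONE — without any class
second moment — excludes Siegel zeros of unbounded quality, modulo Matomäki–Merikoski's Theorem 1.3 (vendored
fact `MatomakiMerikoski2023_pairCorrelation`).  At `N = X = q^{10}`, `w = wlev 20 N`, the shift pairs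
`Ψ₁ = (n, n + 2q)` and `Ψ₂ = (n, n + h₂)`, `h₂ = 2∏_{p ∣ q, 2 < p ≤ w} p ≤ 2√q`, have the same coefficient vector
`(1,1)` and, since `p ∣ 2q ↔ p ∣ h₂` for primes `p ≤ w`, the same incidence types at every prime `≤ w`; so the
`w`-smooth band sums and the smooth scales `G_w` of the core's type-invariant spectrum agree at the two targets,
and type rigidity (R1 of `stub_typeRigidity`, every level) gives `|F₁ − F₂| ≤ 2κG_w ≤ 𝔖(h₂)/5` ((W1) of
`stub_singularWeights`).  The core clause in the Green–Tao dictionary (`vonMangoldtSum/archFactor_shiftPairSystem`)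
reads `|S_i − N F_i| ≤ ε(N|F_i| + N)`, while Matomäki–Merikoski DOUBLES `S₁` (`mm_correction_two_mul`: correction
`+1` at `h = 2q`) and not `S₂` (`|corr_q(h₂)| ≤ √(24h₂/q) ≤ 1/10`, `SiegelCorr.abs_corr_le`); with
`𝔖(h₂) ≤ 𝔖(2q)` this is absurd.  Threshold bookkeeping and `mm_correction_two_mul` are adapted from
`Theorems/LeeYangFibresAbsoluteUpgradeSiegelGuard.lean` (`stub_siegelGuard`).
-/

noncomputable section

open scoped BigOperators Classical Topology ArithmeticFunction.vonMangoldt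
open Finset Filter Literature.NumberTheory.Sieve Literature.Barriers.Parity
open Literature.NumberTheory.Sieve.MontgomeryVaughan1975 (twinPrimeConst_mul_div_totient_le)
open Summit.Parity.GeneralizedHardyLittlewood.Cruxes.RelativeDimOne.GallagherBackwardsSplit
open Summit.Parity.GeneralizedHardyLittlewood.Cruxes.RelativeDimOne.TypeSplit
open Summit.Parity.GeneralizedHardyLittlewood.Theorems.PairsToGHL.Negative

namespace Summit.Parity.GeneralizedHardyLittlewood.Cruxes.RelativeDimOne.FloatingLevelCore

/-! ### Tools: singular series, the correction factor at `h = 2q`, eventual smallness -/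

/-- Monotonicity of the Goldbach singular series along divisibility: for even `m ∣ n`, `n ≠ 0`, `𝔖(m) ≤ 𝔖(n)`
(the odd prime factors of `m` are among those of `n`, and each factor `(p-1)/(p-2) ≥ 1`). [folklore] -/
private theorem goldbachSingularSeries_le_of_dvd {m n : ℕ} (hm : Even m) (hmn : m ∣ n) (hn : n ≠ 0) :
    goldbachSingularSeries m ≤ goldbachSingularSeries n := by
  have hn2 : Even n := even_iff_two_dvd.mpr ((even_iff_two_dvd.mp hm).trans hmn)
  have hC : 0 < twinPrimeConst := twinPrimeConst_pos_holds
  rw [goldbachSingularSeries_of_even m hm, goldbachSingularSeries_of_even n hn2]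
  refine mul_le_mul_of_nonneg_left ?_ (by linarith)
  refine Finset.prod_le_prod_of_subset_of_one_le (Finset.filter_subset_filter _ (Nat.primeFactors_mono hmn hn))
    (fun p hp => ?_) (fun p hp _ => ?_)
  · have hp3 : (3 : ℝ) ≤ p := by exact_mod_cast (Finset.mem_filter.mp hp).2
    exact div_nonneg (by linarith) (by linarith)
  · have hp3 : (3 : ℝ) ≤ p := by exact_mod_cast (Finset.mem_filter.mp hp).2
    rw [le_div_iff₀ (by linarith)]
    linarith

-- adapted from Theorems/LeeYangFibresAbsoluteUpgradeSiegelGuard.lean (`mm_correction_two_mul`, private there)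
/-- At the shift `h = 2q` the correction factor of Matomäki–Merikoski's Theorem 1.3 equals `+1`, so the main term
DOUBLES: `φ(2^r) ∣ 2q` (`r = v₂(q)`), `2q/φ(2^r)` is even, and every prime factor of `q' = q/2^r` divides `2q`
(empty product). [cite: MatomakiMerikoski2023, Theorem 1.3] -/
private theorem mm_correction_two_mul {q : ℕ} (hq : 0 < q) :
    (1 + if Nat.totient (2 ^ padicValNat 2 q) ∣ 2 * q then
        (-1 : ℝ) ^ (2 * q / Nat.totient (2 ^ padicValNat 2 q)) *
          ∏ p ∈ (q / 2 ^ padicValNat 2 q).primeFactors.filter (fun p => ¬ p ∣ 2 * q),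
            (-1 : ℝ) / ((p : ℝ) - 2)
      else 0) = 2 := by
  have _hq := hq
  set r := padicValNat 2 q with hr
  have ht : Nat.totient (2 ^ r) ∣ q := by
    rcases Nat.eq_zero_or_pos r with h0 | hpos
    · rw [h0, pow_zero, Nat.totient_one]; exact one_dvd q
    · rw [Nat.totient_prime_pow Nat.prime_two hpos]
      calc 2 ^ (r - 1) * (2 - 1) = 2 ^ (r - 1) := by norm_num
        _ ∣ 2 ^ r := pow_dvd_pow 2 (Nat.sub_le r 1)
        _ ∣ q := pow_padicValNat_dvd
  have hdvd : Nat.totient (2 ^ r) ∣ 2 * q := ht.trans (dvd_mul_left q 2)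
  have heven : Even (2 * q / Nat.totient (2 ^ r)) := by
    obtain ⟨m, hm⟩ := ht
    have htpos : 0 < Nat.totient (2 ^ r) := Nat.totient_pos.mpr (pow_pos two_pos r)
    refine ⟨m, ?_⟩
    rw [show 2 * q = Nat.totient (2 ^ r) * (m + m) by rw [hm]; ring, Nat.mul_div_cancel_left _ htpos]
  have hempty : (q / 2 ^ r).primeFactors.filter (fun p => ¬ p ∣ 2 * q) = ∅ := by
    refine Finset.filter_eq_empty_iff.mpr fun p hp hndvd => hndvd ?_
    exact ((Nat.dvd_of_mem_primeFactors hp).trans (Nat.div_dvd_of_dvd pow_padicValNat_dvd)).trans (dvd_mul_left q 2)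
  rw [if_pos hdvd, heven.neg_one_pow, hempty, Finset.prod_empty]
  norm_num

/-- `exp(−g(x)) ≤ δ` eventually, for `g → +∞` and `δ > 0`. -/
private theorem eventually_exp_neg_le {g : ℝ → ℝ} (hg : Tendsto g atTop atTop) {δ : ℝ} (hδ : 0 < δ) :
    ∀ᶠ x in atTop, Real.exp (-1 * g x) ≤ δ := by
  have h1 : Tendsto (fun x => Real.exp (-1 * g x)) atTop (𝓝 0) :=
    Real.tendsto_exp_atBot.comp (by simpa using hg.const_mul_atTop_of_neg (by norm_num : (-1 : ℝ) < 0))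
  exact (h1.eventually (gt_mem_nhds hδ)).mono fun _ h => h.le

/-! ### The two shift pairs have the same incidence types at small primes -/

/-- The coefficient vector of `(n, n + h)` is `(1, 1)`, independently of `h`. -/
private theorem coeffs_shiftPairSystem_eq (h₁ h₂ : ℤ) :
    coeffs (shiftPairSystem h₁) = coeffs (shiftPairSystem h₂) := by
  funext i; fin_cases i <;> rfl

/-- The incidence type of `(n, n + h)` modulo `p` depends on `h` only through `gcd(h, p)`. -/
private theorem incType_shiftPairSystem_eq {p : ℕ} {h₁ h₂ : ℤ} (hg : Int.gcd h₁ p = Int.gcd h₂ p) :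
    incType p (coeffs (shiftPairSystem h₂)) (consts (shiftPairSystem h₁)) =
      incType p (coeffs (shiftPairSystem h₂)) (consts (shiftPairSystem h₂)) := by
  unfold incType
  refine Prod.ext ?_ ?_
  · funext i
    fin_cases i <;> simp [coeffs, consts, shiftPairSystem]
  · funext i j
    fin_cases i <;> fin_cases j <;> simp [hg, coeffs, consts, shiftPairSystem]

/-- For a prime `p`: `gcd(h₁, p) = gcd(h₂, p)` as soon as `p ∣ h₁ ↔ p ∣ h₂`. -/
private theorem int_gcd_eq_of_dvd_iff {p h₁ h₂ : ℕ} (hp : p.Prime) (hiff : p ∣ h₁ ↔ p ∣ h₂) :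
    Int.gcd (h₁ : ℤ) p = Int.gcd (h₂ : ℤ) p := by
  rw [Int.gcd_natCast_natCast, Int.gcd_natCast_natCast]
  by_cases h1 : p ∣ h₁
  · rw [Nat.gcd_eq_right h1, Nat.gcd_eq_right (hiff.mp h1)]
  · rw [((Nat.Prime.coprime_iff_not_dvd hp).mpr h1).symm.gcd_eq_one,
      ((Nat.Prime.coprime_iff_not_dvd hp).mpr (mt hiff.mpr h1)).symm.gcd_eq_one]

/-- Type invariance: the `w`-smooth band sum sees the target only through its incidence types at primes `≤ w`. -/
private theorem smoothBand_eq_of_incType {t Q w : ℕ} {a b b' : Fin t → ℤ} {e : ℕ → (Fin t → ℤ) → ℝ}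
    (he : TypeInvariant a e) (h : ∀ p : ℕ, p.Prime → p ≤ w → incType p a b = incType p a b') :
    smoothBand Q w e b = smoothBand Q w e b' := by
  unfold smoothBand
  refine Finset.sum_congr rfl fun q hq => ?_
  simp only [Finset.mem_filter] at hq
  exact he q hq.1.2 b b' fun p hp => h p (Nat.prime_of_mem_primeFactors hp) (hq.2 p hp)

/-- The smooth scale `G_w` sees the target only through its incidence types at primes `≤ w` (type factorisation of
`β_p`, `localFactor_sys_eq_of_incType_eq`). -/
private theorem gscale_eq_of_incType {t w : ℕ} {a b b' : Fin t → ℤ}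
    (h : ∀ p : ℕ, p.Prime → p ≤ w → incType p a b = incType p a b') : gscale w a b = gscale w a b' := by
  unfold gscale wt
  refine Finset.prod_congr rfl fun p hp => ?_
  obtain ⟨hpw, hpp⟩ := Nat.mem_primesLE.mp hp
  rw [localFactor_sys_eq_of_incType_eq p hpp a b b' (h p hpp hpw)]

/-- The `w`-smooth resonant shift: for `w = ⌊log₄(q^{10})⌋/20` and `q ≥ 4800²` there is an even `0 < h₂ ∣ 2q`
with `2400 h₂ ≤ q` and `p ∣ 2q ↔ p ∣ h₂` for every prime `p ≤ w` (namely `h₂ = 2∏_{p ∣ q, p ≠ 2, p ≤ w} p`, which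
is `≤ 2·4^w ≤ 2√q` by `primorial_le_four_pow` and `4^{20w} ≤ N = q^{10}`). -/
private theorem exists_smooth_shift {q : ℕ} (hq : 23040000 ≤ q) :
    ∃ h₂ : ℕ, 0 < h₂ ∧ Even h₂ ∧ h₂ ∣ 2 * q ∧ 2400 * h₂ ≤ q ∧
      ∀ p : ℕ, p.Prime → p ≤ wlev 20 (q ^ 10) → (p ∣ 2 * q ↔ p ∣ h₂) := by
  have hqpos : 0 < q := by omega
  set w : ℕ := wlev 20 (q ^ 10) with hw
  set P : ℕ := ∏ p ∈ q.primeFactors.filter (fun p => p ≠ 2 ∧ p ≤ w), p with hPdef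
  have hPpos : 0 < P := Finset.prod_pos fun p hp => (Nat.prime_of_mem_primeFactors (Finset.mem_filter.mp hp).1).pos
  have hP4 : P ≤ 4 ^ w := by
    calc P ≤ ∏ p ∈ Nat.primesLE w, p :=
          Finset.prod_le_prod_of_subset_of_one_le'
            (fun p hp => Nat.mem_primesLE.mpr
              ⟨(Finset.mem_filter.mp hp).2.2, Nat.prime_of_mem_primeFactors (Finset.mem_filter.mp hp).1⟩)
            (fun p hp _ => (Nat.mem_primesLE.mp hp).2.one_le)
      _ ≤ 4 ^ w := primorial_le_four_pow w
  have h4w : (4 ^ w) ^ 2 ≤ q := by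
    have h1 : ((4 ^ w) ^ 2) ^ 10 ≤ q ^ 10 := by
      calc ((4 ^ w) ^ 2) ^ 10 = 4 ^ (20 * w) := by rw [← pow_mul, ← pow_mul]; ring
        _ ≤ 4 ^ Nat.log 4 (q ^ 10) := Nat.pow_le_pow_right (by norm_num) (Nat.mul_div_le (Nat.log 4 (q ^ 10)) 20)
        _ ≤ q ^ 10 := Nat.pow_log_le_self 4 (pow_pos hqpos 10).ne'
    exact (Nat.pow_le_pow_iff_left (by norm_num)).mp h1
  have hsq : (2 * P) ^ 2 ≤ 4 * q := by nlinarith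
  refine ⟨2 * P, by omega, even_two_mul P, ?_, by nlinarith, fun p hp hpw => ?_⟩
  · exact mul_dvd_mul_left 2 ((Finset.prod_dvd_prod_of_subset _ _ _ (Finset.filter_subset _ _)).trans
      (Nat.prod_primeFactors_dvd q))
  refine ⟨fun hd => ?_, fun hd => ?_⟩
  · rcases eq_or_ne p 2 with rfl | hp2
    · exact dvd_mul_right 2 _
    have hq' : p ∣ q := ((Nat.coprime_primes hp Nat.prime_two).mpr hp2).dvd_of_dvd_mul_left hd
    have hmem : p ∈ q.primeFactors.filter (fun p => p ≠ 2 ∧ p ≤ w) :=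
      Finset.mem_filter.mpr ⟨Nat.mem_primeFactors.mpr ⟨hp, hq', hqpos.ne'⟩, hp2, hpw⟩
    exact (Finset.dvd_prod_of_mem _ hmem).trans (dvd_mul_left _ 2)
  · rcases (Nat.Prime.dvd_mul hp).mp hd with h2 | hP
    · exact h2.trans (dvd_mul_right 2 q)
    · obtain ⟨r, hr, hpr⟩ := (Prime.dvd_finsetProd_iff hp.prime _).mp hP
      have hr' := (Finset.mem_filter.mp hr).1
      rw [(Nat.prime_dvd_prime_iff_eq hp (Nat.prime_of_mem_primeFactors hr')).mp hpr]
      exact (Nat.dvd_of_mem_primeFactors hr').trans (dvd_mul_left q 2)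

/-! ### The stub -/

/-- **`stub_siegelRepulsion` — the bare parity atom repels Siegel zeros of unbounded quality.** Modulo the vendored
theorem of Matomäki–Merikoski (`MatomakiMerikoski2023_pairCorrelation`, Theorem 1.3), the incidence-bandlimited core
with Hardy–Littlewood decay at ANY level `θ > 0` excludes `UnboundedSiegelZeros`: at `N = q^{10}` the resonant
shift `2q` of an exceptional conductor `q` and its `w`-smooth part `h₂` (`exists_smooth_shift`) have the same
incidence types at all primes `≤ w = wlev 20 N`, so no type-invariant decaying spectrum separates them (R1 of
`stub_typeRigidity`, (W1) of `stub_singularWeights`: `|F₁ − F₂| ≤ 𝔖(h₂)/5`), whereas Theorem 1.3 doubles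
`Σ_{n ≤ N} Λ(n)Λ(n + 2q)` and not `Σ_{n ≤ N} Λ(n)Λ(n + h₂)` (`|corr_q(h₂)| ≤ √(24h₂/q) ≤ 1/10`); the core clause
at the two pairs then forces `1.96 𝔖(2q) ≤ F₁ ≤ F₂ + 𝔖(h₂)/5 ≤ 1.34 𝔖(2q)`.
[cite: MatomakiMerikoski2023, Theorem 1.3] [cite: TaoTeravainen2021, Definition 1.4] -/
theorem stub_siegelRepulsion : Literature.Barriers.Parity.MatomakiMerikoski2023_pairCorrelation → ∀ θ : ℝ, 0 < θ → IncidenceBandlimitedCoreDecay θ → ¬ Literature.Barriers.Parity.UnboundedSiegelZeros := by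
  intro hMM θ _hθ hP hU
  have hC₂ : 0 < twinPrimeConst := twinPrimeConst_pos_holds
  -- constants, in this order: `C`, `C_w`, `κ`, `ε`, `N₁`, `N₂`, `K`, `δ`
  obtain ⟨C, hC, hP'⟩ := hP 2 3 (by norm_num)
  obtain ⟨Cw, hCw, hW1⟩ := stub_singularWeights.1 2 (by norm_num)
  obtain ⟨κ, hκdef⟩ : ∃ κ : ℝ, κ = 1 / (10 * Cw) := ⟨_, rfl⟩
  have hκ : 0 < κ := by rw [hκdef]; positivity
  have hκCw : κ * Cw = 1 / 10 := by rw [hκdef]; field_simp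
  obtain ⟨ε, hεdef⟩ : ∃ ε : ℝ, ε = min (1 / 100) (twinPrimeConst / 100) := ⟨_, rfl⟩
  have hε : 0 < ε := by rw [hεdef]; exact lt_min (by norm_num) (by positivity)
  have hε1 : ε ≤ 1 / 100 := by rw [hεdef]; exact min_le_left _ _
  have hεC : ε ≤ twinPrimeConst / 100 := by rw [hεdef]; exact min_le_right _ _
  obtain ⟨N₁, hN₁⟩ := hP' ε hε
  obtain ⟨N₂, hN₂⟩ := stub_typeRigidity 2 3 20 C κ (by norm_num) (by norm_num) hC hκ
  obtain ⟨K, hK, hMM'⟩ := hMM 1 le_rfl (1 / 10) (by norm_num) 1 one_pos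
  obtain ⟨δ, hδ⟩ : ∃ δ : ℝ, δ = twinPrimeConst / (300 * K) := ⟨_, rfl⟩
  have hδpos : 0 < δ := by rw [hδ]; positivity
  -- thresholds: the three error terms of Matomäki–Merikoski are eventually `≤ δ`
  have hT1 : ∀ᶠ η : ℝ in atTop, Real.exp (-1 * Real.sqrt (10 * Real.log η)) ≤ δ :=
    eventually_exp_neg_le (Real.tendsto_sqrt_atTop.comp (Real.tendsto_log_atTop.const_mul_atTop (by norm_num))) hδpos
  have hT2 : ∀ᶠ η : ℝ in atTop, 10 * Real.log η ^ (6 : ℕ) / η ≤ δ := by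
    have h1 : Tendsto (fun η : ℝ => 10 * Real.log η ^ (6 : ℕ) / η) atTop (𝓝 0) := by
      have := (Real.tendsto_pow_log_div_mul_add_atTop 1 0 6 one_ne_zero).const_mul 10
      rw [mul_zero] at this
      exact this.congr' (Eventually.of_forall fun η => by simp only [one_mul, add_zero]; ring)
    exact (h1.eventually (gt_mem_nhds hδpos)).mono fun _ h => h.le
  have hT3 : ∀ᶠ X : ℝ in atTop, Real.exp (-1 * Real.log X ^ (3 / 5 - 1 / 10 : ℝ)) ≤ δ :=
    eventually_exp_neg_le ((tendsto_rpow_atTop (by norm_num)).comp Real.tendsto_log_atTop) hδpos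
  obtain ⟨η₁, hη₁⟩ := eventually_atTop.mp (hT1.and hT2)
  obtain ⟨X₁, hX₁⟩ := eventually_atTop.mp hT3
  -- a Siegel zero of quality `η ≥ η₁` at a conductor `q ≥ max N₁ N₂ ⌈X₁⌉ 4800²`; `N = X = q^10`
  obtain ⟨q, inst, χ, η, hq, hη, hprim, hquad, hη10, hL⟩ :=
    hU η₁ (max N₁ (max N₂ (max ⌈X₁⌉₊ 23040000)))
  simp only [max_le_iff] at hq
  obtain ⟨hqN₁, hqN₂, hqX₁, hqQ₀⟩ := hq
  have hq2 : 2 ≤ q := by omega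
  have hqpos : 0 < q := by omega
  have hq0 : (0 : ℝ) < q := by exact_mod_cast hqpos
  obtain ⟨h₂, hh₂pos, hh₂even, hh₂dvd, h2400, hdvd_iff⟩ := exists_smooth_shift hqQ₀
  set N : ℕ := q ^ 10 with hN
  have hNpos : 0 < N := pow_pos hqpos 10
  have hNr : (0 : ℝ) < N := by exact_mod_cast hNpos
  have hqN : q ≤ N := Nat.le_self_pow (by norm_num) q
  have h2qN : 2 * q ≤ N := by
    calc 2 * q ≤ q ^ 2 := by nlinarith
      _ ≤ q ^ 10 := Nat.pow_le_pow_right hqpos (by norm_num)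
  have hh₂N : h₂ ≤ N := (Nat.le_of_dvd (by omega) hh₂dvd).trans h2qN
  set X : ℝ := (q : ℝ) ^ (10 : ℝ) with hXdef
  have hXN : X = (N : ℝ) := by
    rw [hXdef, hN, show (10 : ℝ) = ((10 : ℕ) : ℝ) by norm_num, Real.rpow_natCast, Nat.cast_pow]
  -- Matomäki–Merikoski at `h₁ = 2q` (correction `+1`) and at `h₂` (`corr₂ ≤ √(24h₂/q) ≤ 1/10`)
  have hA₁ : ((2 * q : ℕ) : ℝ) ≤ 1 * X := by rw [hXN, one_mul]; exact_mod_cast h2qN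
  have hA₂ : (h₂ : ℝ) ≤ 1 * X := by rw [hXN, one_mul]; exact_mod_cast hh₂N
  have hM₁ := hMM' q hq2 χ hprim hquad η hη10 hL 10 X le_rfl hXdef (2 * q) (by omega) hA₁
  rw [mm_correction_two_mul hqpos, hXN, Nat.floor_natCast] at hM₁
  have hM₂ := hMM' q hq2 χ hprim hquad η hη10 hL 10 X le_rfl hXdef h₂ hh₂pos hA₂
  rw [hXN, Nat.floor_natCast] at hM₂
  have hsqrt : Real.sqrt (24 * h₂ / q) ≤ 1 / 10 := by
    refine Real.sqrt_le_iff.mpr ⟨by norm_num, ?_⟩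
    rw [div_le_iff₀ hq0]
    have h' : ((2400 * h₂ : ℕ) : ℝ) ≤ (q : ℝ) := by exact_mod_cast h2400
    push_cast at h'
    nlinarith [h']
  set corr₂ : ℝ := (if Nat.totient (2 ^ padicValNat 2 q) ∣ h₂ then
      (-1 : ℝ) ^ (h₂ / Nat.totient (2 ^ padicValNat 2 q)) *
        ∏ p ∈ (q / 2 ^ padicValNat 2 q).primeFactors.filter (fun p => ¬ p ∣ h₂), (-1 : ℝ) / ((p : ℝ) - 2)
      else 0) with hcorr₂def
  have hcorr₂ : corr₂ ≤ 1 / 10 :=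
    (le_abs_self _).trans ((SiegelCorr.abs_corr_le χ hprim hquad (show 1 ≤ h₂ from hh₂pos)).trans hsqrt)
  -- the core's spectrum at scale `N` and its clause at the two shift pairs on `[-N, N]` (Green–Tao dictionary)
  obtain ⟨f, hInv, hDec, hApprox⟩ := hN₁ N (hqN₁.trans hqN)
  have hnd₁ : IsNondegenerateSystem (shiftPairSystem ((2 * q : ℕ) : ℤ)) :=
    isNondegenerateSystem_shiftPairSystem_iff.mpr (by exact_mod_cast (show 2 * q ≠ 0 by omega))
  have hnd₂ : IsNondegenerateSystem (shiftPairSystem (h₂ : ℤ)) :=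
    isNondegenerateSystem_shiftPairSystem_iff.mpr (by exact_mod_cast hh₂pos.ne')
  have hsz₁ : affLinSize (shiftPairSystem ((2 * q : ℕ) : ℤ)) (N : ℝ) ≤ ((3 : ℕ) : ℝ) :=
    affLinSize_shiftPairSystem_le hNpos h2qN
  have hsz₂ : affLinSize (shiftPairSystem (h₂ : ℤ)) (N : ℝ) ≤ ((3 : ℕ) : ℝ) :=
    affLinSize_shiftPairSystem_le hNpos hh₂N
  have hc₁ := hApprox _ hnd₁ hsz₁ (realBox 1 N) (convex_Icc _ _) subset_rfl
  have hc₂ := hApprox _ hnd₂ hsz₂ (realBox 1 N) (convex_Icc _ _) subset_rfl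
  rw [vonMangoldtSum_shiftPairSystem, archFactor_shiftPairSystem,
    coeffs_shiftPairSystem_eq ((2 * q : ℕ) : ℤ) (h₂ : ℤ)] at hc₁
  rw [vonMangoldtSum_shiftPairSystem, archFactor_shiftPairSystem] at hc₂
  set a : Fin 2 → ℤ := coeffs (shiftPairSystem (h₂ : ℤ)) with ha
  set b₁ : Fin 2 → ℤ := consts (shiftPairSystem ((2 * q : ℕ) : ℤ)) with hb₁
  set b₂ : Fin 2 → ℤ := consts (shiftPairSystem (h₂ : ℤ)) with hb₂
  have hsys₁ : sys a b₁ = shiftPairSystem ((2 * q : ℕ) : ℤ) := by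
    rw [ha, hb₁, ← coeffs_shiftPairSystem_eq ((2 * q : ℕ) : ℤ) (h₂ : ℤ)]
    exact sys_coeffs_consts _
  have hsys₂ : sys a b₂ = shiftPairSystem (h₂ : ℤ) := sys_coeffs_consts _
  have hndS₁ : IsNondegenerateSystem (sys a b₁) := by rw [hsys₁]; exact hnd₁
  have hndS₂ : IsNondegenerateSystem (sys a b₂) := by rw [hsys₂]; exact hnd₂
  obtain ⟨hab, hb₁b⟩ := EndgameProof.coeff_bounds (L := 3) hNpos hndS₁ (by rw [hsys₁]; exact hsz₁)
  obtain ⟨-, hb₂b⟩ := EndgameProof.coeff_bounds (L := 3) hNpos hndS₂ (by rw [hsys₂]; exact hsz₂)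
  -- type rigidity (R1) at the two targets; the smooth band sums and the smooth scales AGREE (same incidence types)
  have hR₁ := (hN₂ N (hqN₂.trans hqN) (level θ N) a hab (f a) (hInv a) (hDec a) b₁ hb₁b hndS₁).1
  have hR₂ := (hN₂ N (hqN₂.trans hqN) (level θ N) a hab (f a) (hInv a) (hDec a) b₂ hb₂b hndS₂).1
  have hinc : ∀ p : ℕ, p.Prime → p ≤ wlev 20 N → incType p a b₁ = incType p a b₂ := fun p hp hpw =>
    incType_shiftPairSystem_eq (int_gcd_eq_of_dvd_iff hp (hdvd_iff p hp hpw))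
  rw [smoothBand_eq_of_incType (hInv a) hinc, gscale_eq_of_incType hinc] at hR₁
  -- singular series: `𝔖_i = ∏_p β_p(Ψ_i)`, `C₂ ρ_i ≤ 𝔖_i`, `𝔖₂ ≤ 𝔖₁`; (W1): `κ G_w ≤ κ C_w 𝔖₂ = 𝔖₂ / 10`
  have h𝔖₂eq : singularProduct (sys a b₂) = goldbachSingularSeries h₂ := by
    rw [hsys₂]; exact singularProduct_shiftPairSystem hh₂even hh₂pos.ne'
  set 𝔖₁ : ℝ := goldbachSingularSeries (2 * q) with h𝔖₁
  set 𝔖₂ : ℝ := goldbachSingularSeries h₂ with h𝔖₂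
  set ρ₁ : ℝ := ((2 * q : ℕ) : ℝ) / (Nat.totient (2 * q) : ℝ) with hρ₁
  set ρ₂ : ℝ := (h₂ : ℝ) / (Nat.totient h₂ : ℝ) with hρ₂
  have hρ : ∀ m : ℕ, 0 < m → (1 : ℝ) ≤ (m : ℝ) / (Nat.totient m : ℝ) := fun m hm => by
    rw [le_div_iff₀ (by exact_mod_cast Nat.totient_pos.mpr hm), one_mul]
    exact_mod_cast Nat.totient_le m
  have hρ₁1 : 1 ≤ ρ₁ := hρ (2 * q) (by omega)
  have hρ₂1 : 1 ≤ ρ₂ := hρ h₂ hh₂pos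
  have h𝔖ρ₁ : twinPrimeConst * ρ₁ ≤ 𝔖₁ := twinPrimeConst_mul_div_totient_le (even_two_mul q) (by omega)
  have h𝔖ρ₂ : twinPrimeConst * ρ₂ ≤ 𝔖₂ := twinPrimeConst_mul_div_totient_le hh₂even hh₂pos.ne'
  have h𝔖C₁ : twinPrimeConst ≤ 𝔖₁ := (le_mul_of_one_le_right hC₂.le hρ₁1).trans h𝔖ρ₁
  have h𝔖C₂ : twinPrimeConst ≤ 𝔖₂ := (le_mul_of_one_le_right hC₂.le hρ₂1).trans h𝔖ρ₂
  have h𝔖₂₁ : 𝔖₂ ≤ 𝔖₁ := goldbachSingularSeries_le_of_dvd hh₂even hh₂dvd (by omega)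
  have hκG : κ * gscale (wlev 20 N) a b₂ ≤ 𝔖₂ / 10 := by
    have hGW := hW1 (wlev 20 N) a b₂ hndS₂ (by rw [h𝔖₂eq]; linarith)
    rw [h𝔖₂eq] at hGW
    calc κ * gscale (wlev 20 N) a b₂ ≤ κ * (Cw * 𝔖₂) := mul_le_mul_of_nonneg_left hGW hκ.le
      _ = (κ * Cw) * 𝔖₂ := by ring
      _ = 𝔖₂ / 10 := by rw [hκCw]; ring
  set F₁ : ℝ := sfBand (level θ N) (f a) b₁ with hF₁
  set F₂ : ℝ := sfBand (level θ N) (f a) b₂ with hF₂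
  have hF₁₂ : F₁ ≤ F₂ + 𝔖₂ / 5 := by
    rw [abs_le] at hR₁ hR₂
    linarith [hR₁.1, hR₁.2, hR₂.1, hR₂.2]
  -- the three error terms of Matomäki–Merikoski are `≤ δ`, so `K ρ_i N · 3δ = N C₂ ρ_i / 100 ≤ N 𝔖_i / 100`
  obtain ⟨hE1, hE2⟩ := hη₁ η hη
  have hE3 := hX₁ (N : ℝ) ((Nat.le_ceil X₁).trans (by exact_mod_cast hqX₁.trans hqN))
  have hKρN₁ : 0 ≤ K * ρ₁ * (N : ℝ) := by positivity
  have hKρN₂ : 0 ≤ K * ρ₂ * (N : ℝ) := by positivity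
  have h3δ₁ : K * ρ₁ * (N : ℝ) * (3 * δ) = (N : ℝ) * (twinPrimeConst * ρ₁) / 100 := by
    rw [hδ]; field_simp; ring
  have h3δ₂ : K * ρ₂ * (N : ℝ) * (3 * δ) = (N : ℝ) * (twinPrimeConst * ρ₂) / 100 := by
    rw [hδ]; field_simp; ring
  set S₁ : ℝ := ∑ n ∈ Icc 1 N, Λ n * Λ (n + 2 * q) with hS₁
  set S₂ : ℝ := ∑ n ∈ Icc 1 N, Λ n * Λ (n + h₂) with hS₂
  have hlow₁ : (N : ℝ) * 𝔖₁ * 2 - N * 𝔖₁ / 100 ≤ S₁ := by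
    have hM₁' : |S₁ - (N : ℝ) * 𝔖₁ * 2| ≤ K * ρ₁ * N * (3 * δ) :=
      hM₁.trans (mul_le_mul_of_nonneg_left (by linarith) hKρN₁)
    rw [h3δ₁] at hM₁'
    have ha := neg_abs_le (S₁ - (N : ℝ) * 𝔖₁ * 2)
    have hb : (N : ℝ) * (twinPrimeConst * ρ₁) ≤ N * 𝔖₁ := mul_le_mul_of_nonneg_left h𝔖ρ₁ hNr.le
    linarith
  have hup₂ : S₂ ≤ (N : ℝ) * 𝔖₂ + N * 𝔖₂ / 10 + N * 𝔖₂ / 100 := by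
    have hM₂' : |S₂ - (N : ℝ) * 𝔖₂ * (1 + corr₂)| ≤ K * ρ₂ * N * (3 * δ) :=
      hM₂.trans (mul_le_mul_of_nonneg_left (by linarith) hKρN₂)
    rw [h3δ₂] at hM₂'
    have ha := le_abs_self (S₂ - (N : ℝ) * 𝔖₂ * (1 + corr₂))
    have hb : (N : ℝ) * (twinPrimeConst * ρ₂) ≤ N * 𝔖₂ := mul_le_mul_of_nonneg_left h𝔖ρ₂ hNr.le
    have hc : (N : ℝ) * 𝔖₂ * corr₂ ≤ N * 𝔖₂ * (1 / 10) :=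
      mul_le_mul_of_nonneg_left hcorr₂ (mul_nonneg hNr.le (hC₂.le.trans h𝔖C₂))
    linarith
  -- the core clause `|S_i − N F_i| ≤ ε (N|F_i| + N)` with `ε ≤ 1/100` and `ε ≤ C₂/100 ≤ 𝔖_i/100`
  have hεN : ε * (N : ℝ) ≤ twinPrimeConst / 100 * N := mul_le_mul_of_nonneg_right hεC hNr.le
  have hcore₁ : S₁ ≤ (N : ℝ) * F₁ + N * |F₁| / 100 + N * 𝔖₁ / 100 := by
    have h1 := le_abs_self (S₁ - N * F₁)
    have h2 : ε * ((N : ℝ) * |F₁|) ≤ 1 / 100 * ((N : ℝ) * |F₁|) :=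
      mul_le_mul_of_nonneg_right hε1 (by positivity)
    have h4 : twinPrimeConst * (N : ℝ) ≤ 𝔖₁ * N := mul_le_mul_of_nonneg_right h𝔖C₁ hNr.le
    linarith [hc₁]
  have hcore₂ : (N : ℝ) * F₂ - N * |F₂| / 100 - N * 𝔖₂ / 100 ≤ S₂ := by
    have h1 := neg_abs_le (S₂ - N * F₂)
    have h2 : ε * ((N : ℝ) * |F₂|) ≤ 1 / 100 * ((N : ℝ) * |F₂|) :=
      mul_le_mul_of_nonneg_right hε1 (by positivity)
    have h4 : twinPrimeConst * (N : ℝ) ≤ 𝔖₂ * N := mul_le_mul_of_nonneg_right h𝔖C₂ hNr.le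
    linarith [hc₂]
  -- divide by `N` and conclude: `1.96 𝔖₁ ≤ F₁ ≤ F₂ + 𝔖₂ / 5 ≤ 1.34 𝔖₁`, against `𝔖₁ ≥ C₂ > 0`
  have hkey₁ : 𝔖₁ * 2 - 𝔖₁ / 100 - 𝔖₁ / 100 ≤ F₁ + |F₁| / 100 := by
    refine le_of_mul_le_mul_left ?_ hNr
    linarith
  have hkey₂ : F₂ - |F₂| / 100 ≤ 𝔖₂ + 𝔖₂ / 10 + 𝔖₂ / 100 + 𝔖₂ / 100 := by
    refine le_of_mul_le_mul_left ?_ hNr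
    linarith
  rcases abs_cases F₁ with ⟨hF₁a, hF₁s⟩ | ⟨hF₁a, hF₁s⟩ <;>
    rcases abs_cases F₂ with ⟨hF₂a, hF₂s⟩ | ⟨hF₂a, hF₂s⟩ <;>
    · rw [hF₁a] at hkey₁
      rw [hF₂a] at hkey₂
      linarith only [hkey₁, hkey₂, hF₁₂, h𝔖₂₁, h𝔖C₁, hC₂, hF₁s, hF₂s]

end Summit.Parity.GeneralizedHardyLittlewood.Cruxes.RelativeDimOne.FloatingLevelCore

end
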